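import Literature.NumberTheory.GaloisRepresentations.GaloisRep
import HarnessLib

/-!
# Tate's lifting theorem, finite projective image case: an `ℓ`-adic representation of `Γ_K`
# some open subgroup of which acts by scalars is a character twist of a finite-image
# representation

Trunk: GaloisRepresentations (cite item `wi-38103`, for crux `stmt-Langlands-14329`, region
`prime-rank-transport`, stub K4b; the typed shape `TateFiniteProjectiveLift` of that region's
skeleton is reproduced here in Literature vocabulary).

## The printed results

* **Tate** (J.-P. Serre, *Modular forms of weight one and Galois representations*, Durham 1975
  (1977), §6.5, Thm. 4 and its Corollary): for a number field `K`, `H²(G_K, ℚ/ℤ) = 0`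
  (equivalently `H²(G_K, ℂ^×) = 0` for the trivial discrete module `ℂ^×`); hence every continuous
  projective representation `G_K → PGL_n(ℂ)` lifts to a continuous linear representation
  `G_K → GL_n(ℂ)` (of finite image).
* **Conrad–Patrikis, the `ℚ̄_ℓ`-form** (S. Patrikis, *Variations on a theorem of Tate*, Mem. AMS
  258 (2019) no. 1238 = arXiv:1207.6724, §1: Thm. 1.0.16 "Theorem (Tate). Let `F` be a number
  field. Then `H²(Γ_F, ℚ/ℤ) = 0`", and Prop. 1.0.18 "(5.3 of [Conrad, *Lifting global
  representations with local properties*]). Let `H' ↠ H` be a surjection of linear algebraic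
  groups over `ℚ̄_ℓ` with kernel a central torus. Then any continuous representation
  `ρ : Γ_F → H(ℚ̄_ℓ)` lifts to `H'(ℚ̄_ℓ)`" — numbering of the arXiv version; the proof lifts
  through `H'_m = H'_1 · S^∨[m] ↠ H` with FINITE kernel `μ_m` for `m` large, killing the
  obstruction in `H²(Γ_F, ℤ/m)` by Tate's theorem).

Applied to `GL_n ↠ PGL_n` and the projectivisation `r̄ : Γ_K → PGL_n(ℚ̄_ℓ)` of a continuous
`r : Γ_K → GL_n(ℚ̄_ℓ)` some open subgroup `Γ_F` of which acts by scalars: `r̄` is continuous with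
FINITE image (it kills `Γ_F`), so the lift `σ : Γ_K → (SL_n · μ_m)(ℚ̄_ℓ) ⊆ GL_n(ℚ̄_ℓ)` of
Prop. 1.0.18 has finite image (an extension of `r̄(Γ_K)` by a subgroup of `μ_m`), and
`ψ(g) := r(g) σ(g)⁻¹` is a scalar matrix for every `g`, multiplicative because `σ` is, and
continuous because `r` and `σ` are: `r = ψ ⊗ σ` with `σ` of finite image and `ψ : Γ_K → ℚ̄_ℓ^×` a
continuous character.  This consequence is what the region uses and what is vendored below.

## Main statements

* `FramedGaloisRep.HasFiniteProjectiveImage r` — DEFINITION (the region skeleton's §0 notion,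
  same body): some finite extension `F/K` has `Γ_F` acting through `r` by scalars.
* `FramedGaloisRep.hasFiniteProjectiveImage_one` — the trivial representation has it (API /
  non-vacuity, `F = K`).
* `Tate_finiteProjectiveImage_eq_twist_finiteImage` — NAMED FACT (D-0014): the consequence above.

## References

* J.-P. Serre, *Modular forms of weight one and Galois representations*, in: Algebraic Number
  Fields (Durham 1975), Academic Press (1977), 193–268, §6.5 (Thm. 4, Cor.). [Serre1977Durham]
* S. Patrikis, *Variations on a theorem of Tate*, Mem. Amer. Math. Soc. 258 (2019), no. 1238
  (arXiv:1207.6724), §1, Thm. 1.0.16 and Prop. 1.0.18 (arXiv numbering). [Patrikis2019Variations]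
-/

noncomputable section

open Field

namespace Literature.NumberTheory.GaloisRepresentations

universe u

variable {K : Type} [Field K] {A : Type u} [CommRing A] [TopologicalSpace A] {n : ℕ}

/-- **Finite projective image**: some open subgroup of `Γ_K` acts by scalars through `r`, i.e.
there is a finite extension `F/K` (a number field `F` with a `K`-algebra structure) such that
`r(res σ)` is a scalar matrix for every `σ ∈ Γ_F` (`FramedGaloisRep.restrictField`).  Equivalently
(for `K` a number field) the projectivisation `r̄ : Γ_K → PGL_n(A)` has finite image.  This is the
§0 notion `HasFiniteProjectiveImage` of the region skeleton `prime-rank-transport` of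
`stmt-Langlands-14329`, same body. [folklore] -/
def FramedGaloisRep.HasFiniteProjectiveImage (r : FramedGaloisRep K A n) : Prop :=
  ∃ (F : Type) (_ : Field F) (_ : NumberField F) (_ : Algebra K F),
    ∀ σ : absoluteGaloisGroup F, ∃ c : A,
      ((r.restrictField F σ : GL (Fin n) A) : Matrix (Fin n) (Fin n) A) =
        c • (1 : Matrix (Fin n) (Fin n) A)

/-- The trivial representation of `Γ_K`, `K` a number field, has finite projective image
(`F = K`, `c = 1`). [folklore] -/
theorem FramedGaloisRep.hasFiniteProjectiveImage_one [NumberField K] :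
    (1 : FramedGaloisRep K A n).HasFiniteProjectiveImage :=
  ⟨K, inferInstance, inferInstance, inferInstance, fun σ => ⟨1, by
    simp [FramedGaloisRep.restrictField_apply]⟩⟩

/-- **Tate's lifting theorem, finite projective image case (Tate; Conrad–Patrikis over `ℚ̄_ℓ`).**
Let `K` be a number field and `r : Γ_K →ₜ* GL_n(ℚ̄_ℓ)` a continuous representation some open
subgroup `Γ_F` of which acts by scalars (`HasFiniteProjectiveImage`).  Then there are a continuous
`σ : Γ_K →ₜ* GL_n(ℚ̄_ℓ)` with FINITE image and a continuous character `ψ : Γ_K →ₜ* GL_1(ℚ̄_ℓ)`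
with `r(g) = ψ(g) · σ(g)` for all `g`.  From Tate's theorem `H²(G_K, ℚ/ℤ) = 0` (Serre 1977,
§6.5, Thm. 4 and Cor.: every projective representation of `G_K` lifts) in the `ℚ̄_ℓ`-form of
Conrad–Patrikis (Patrikis 2019, arXiv numbering Thm. 1.0.16 and Prop. 1.0.18 = Conrad's
Prop. 5.3: every continuous `Γ_K → H(ℚ̄_ℓ)` lifts through a central-torus quotient `H' ↠ H`),
applied to `GL_n ↠ PGL_n` and the finite-image projectivisation of `r`: the lift `σ` lands in
`SL_n · μ_m` over a finite quotient, hence has finite image, and `ψ := r σ⁻¹` is scalar,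
multiplicative and continuous (see the module docstring).  Named fact (D-0014).
[cite: Serre1977Durham, §6.5 Thm. 4] [cite: Patrikis2019Variations, §1 Prop. 1.0.18] -/
def Tate_finiteProjectiveImage_eq_twist_finiteImage : Prop :=
  ∀ (K : Type) [Field K] [NumberField K] (ℓ : ℕ) [Fact ℓ.Prime] (n : ℕ)
    (r : FramedGaloisRep K (PadicAlgCl ℓ) n), r.HasFiniteProjectiveImage →
      ∃ (σ : FramedGaloisRep K (PadicAlgCl ℓ) n) (ψ : FramedGaloisRep K (PadicAlgCl ℓ) 1),
        (Set.range σ).Finite ∧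
          ∀ g : absoluteGaloisGroup K,
            ((r g : GL (Fin n) (PadicAlgCl ℓ)) : Matrix (Fin n) (Fin n) (PadicAlgCl ℓ)) =
              ((ψ g : GL (Fin 1) (PadicAlgCl ℓ)) : Matrix (Fin 1) (Fin 1) (PadicAlgCl ℓ)) 0 0 •
                ((σ g : GL (Fin n) (PadicAlgCl ℓ)) : Matrix (Fin n) (Fin n) (PadicAlgCl ℓ))

end Literature.NumberTheory.GaloisRepresentations

end
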